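import Literature.MathematicalPhysics.QuantumManyBody.PeriodicBoseGasEq317Bdd
import Literature.MathematicalPhysics.QuantumManyBody.WeightedCorrector
import Literature.MathematicalPhysics.QuantumManyBody.PeriodicBoseGasFourier
import HarnessLib

/-!
# The translation-averaged coherence of a periodic `N`-body state

Topic `Literature/MathematicalPhysics/QuantumManyBody`, namespace `BoseGas`. For a periodic `C¹`
trial state `Ψ` of `n+1` bosons on the torus of side `L` (`PeriodicTrialState`, `PeriodicBoseGas.lean`)
the **translation-averaged one-body coherence**
`g(r) = ∫_cell dx ∫_{cell^n} dY |Ψ(x+r,Y)| |Ψ(x,Y)|` (`ρ⁻¹ ×` the translation average of the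
one-body density matrix when `Ψ ≥ 0`; the object whose long-range order is Bose–Einstein
condensation, [LSSY2005, §1.2 (1.17)–(1.19)], and whose logarithm carries the Lévy/phase weights of
the infrared bookkeeping of [Stringari1995, §2], [MoraCastin2003, §4.3]). Written with the explicit
double integral (no new definition), this file supplies its elementary regularity:

* `continuous_slicePairing`, `continuous_coherenceFun` — joint continuity of
  `(r,x) ↦ ∫_{cell^n}|Ψ(x+r,Y)||Ψ(x,Y)|dY` and continuity of `g` (dominated convergence, `Ψ`
  bounded: `PeriodicTrialState.exists_norm_le`);
* `coherenceFun_add_single` — `Lℤ³`-periodicity of `g` along the axes;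
* `coherenceFun_pos` — `g > 0` for a nowhere-vanishing state;
* `lintegral_slicePairing_eq_ofReal` — `∫⁻∫⁻ ofReal(…) = ofReal g(r)`;
* `re_cellFourierCoeff_zero_ofReal` (`Re ĉ₀(h) = L⁻³∫_cell h` for real `h`), `continuous_ofReal_log`,
  and `volume_mul_one_add_zero_mode_le` — **`L³(1 + Re ĉ₀(log g)) ≤ ∫_cell g`** for continuous
  positive `g` (`g ≥ 1 + log g` pointwise: the elementary substitute for Jensen's inequality in
  step (ii) of the infrared chain).

## References

* E. H. Lieb, R. Seiringer, J. P. Solovej, J. Yngvason, *The Mathematics of the Bose Gas and its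
  Condensation*, Birkhäuser 2005, §1.2 (1.17)–(1.19). [`LSSY2005`]
* S. Stringari, in *Bose–Einstein Condensation*, CUP 1995, §2. [`Stringari1995`]
* C. Mora, Y. Castin, Phys. Rev. A 67 (2003) 053615, §4.3. [`MoraCastin2003`]
-/

noncomputable section

open MeasureTheory Filter Set WithLp Complex
open scoped ENNReal NNReal

namespace Literature.MathematicalPhysics.QuantumManyBody.BoseGas

section Coherence

variable {n : ℕ} {L : ℝ}

/-- Volume of the `N`-particle cell is finite. [folklore] -/
theorem cellN_volume_lt_top (N : ℕ) (L : ℝ) : volume (cellN N L) < ⊤ := by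
  rw [volume_cellN]; exact ENNReal.pow_lt_top (ENNReal.pow_lt_top ENNReal.ofReal_lt_top)

/-- Volume of the `N`-particle cell is positive for `L > 0`. [folklore] -/
theorem cellN_volume_pos (hL : 0 < L) (N : ℕ) : 0 < volume (cellN N L) := by
  rw [volume_cellN]; exact ENNReal.pow_pos (ENNReal.pow_pos (ENNReal.ofReal_pos.2 hL) _) _

/-- Volume of the cell is positive for `L > 0`. [folklore] -/
theorem cell_volume_pos (hL : 0 < L) : 0 < volume (cell L) := by
  rw [volume_cell]; exact ENNReal.pow_pos (ENNReal.ofReal_pos.2 hL) _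

/-- Periodicity of a trial state in the tagged coordinate along an axis (slice form). [folklore] -/
theorem PeriodicTrialState.vecCons_add_axis (Ψ : PeriodicTrialState (n + 1) L) (u : Space)
    (Y : Config n) (k : Fin 3) :
    Ψ.ψ (Matrix.vecCons (u + EuclideanSpace.single k L) Y) = Ψ.ψ (Matrix.vecCons u Y) := by
  have h : (Matrix.vecCons (u + EuclideanSpace.single k L) Y : Config (n + 1)) =
      Matrix.vecCons u Y + Pi.single (0 : Fin (n + 1)) (EuclideanSpace.single k L : Space) := by
    funext j
    refine Fin.cases ?_ (fun i => ?_) j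
    · simp
    · simp
  rw [h, Ψ.periodic]

/-- **Joint continuity of the slice pairing** `(r, x) ↦ ∫_{cell^n} |Ψ(x+r,Y)||Ψ(x,Y)| dY`
(dominated convergence; `Ψ` is bounded). [folklore] -/
theorem continuous_slicePairing (hL : 0 < L) (Ψ : PeriodicTrialState (n + 1) L) :
    Continuous fun p : Space × Space => ∫ Y in cellN n L,
      ‖Ψ.ψ (Matrix.vecCons (p.2 + p.1) Y)‖ * ‖Ψ.ψ (Matrix.vecCons p.2 Y)‖ := by
  obtain ⟨M, hM⟩ := Ψ.exists_norm_le hL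
  have hM0 : 0 ≤ M := (norm_nonneg _).trans (hM 0)
  have hc := Ψ.contDiff.continuous
  refine continuous_of_dominated (bound := fun _ => M * M) ?_ ?_ ?_ ?_
  · intro p
    exact (Continuous.mul (by fun_prop) (by fun_prop)).aestronglyMeasurable
  · intro p
    refine Eventually.of_forall fun Y => ?_
    rw [Real.norm_eq_abs, abs_mul, abs_norm, abs_norm]
    exact mul_le_mul (hM _) (hM _) (norm_nonneg _) hM0
  · exact integrableOn_const (cellN_volume_lt_top n L).ne
  · exact Eventually.of_forall fun Y => by fun_prop

/-- **Continuity of the coherence** `r ↦ g(r) = ∫_cell∫_{cell^n} |Ψ(x+r,Y)||Ψ(x,Y)|`. [folklore] -/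
theorem continuous_coherenceFun (hL : 0 < L) (Ψ : PeriodicTrialState (n + 1) L) :
    Continuous fun r : Space => ∫ x in cell L, ∫ Y in cellN n L,
      ‖Ψ.ψ (Matrix.vecCons (x + r) Y)‖ * ‖Ψ.ψ (Matrix.vecCons x Y)‖ := by
  obtain ⟨M, hM⟩ := Ψ.exists_norm_le hL
  have hM0 : 0 ≤ M := (norm_nonneg _).trans (hM 0)
  have hj := continuous_slicePairing hL Ψ
  refine continuous_of_dominated (bound := fun _ => M * M * (volume : Measure (Config n)).real (cellN n L))
    ?_ ?_ ?_ ?_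
  · intro r
    exact (hj.comp (Continuous.prodMk continuous_const continuous_id)).aestronglyMeasurable
  · intro r
    refine Eventually.of_forall fun x => ?_
    refine norm_setIntegral_le_of_norm_le_const (cellN_volume_lt_top n L) fun Y _ => ?_
    rw [Real.norm_eq_abs, abs_mul, abs_norm, abs_norm]
    exact mul_le_mul (hM _) (hM _) (norm_nonneg _) hM0
  · exact integrableOn_const (by rw [volume_cell]; exact (ENNReal.pow_lt_top ENNReal.ofReal_lt_top).ne)
  · exact Eventually.of_forall fun x =>
      hj.comp (Continuous.prodMk continuous_id continuous_const)

/-- **Periodicity of the coherence** along the axes. [folklore] -/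
theorem coherenceFun_add_single (Ψ : PeriodicTrialState (n + 1) L) (r : Space) (k : Fin 3) :
    (∫ x in cell L, ∫ Y in cellN n L,
      ‖Ψ.ψ (Matrix.vecCons (x + (r + EuclideanSpace.single k L)) Y)‖ * ‖Ψ.ψ (Matrix.vecCons x Y)‖) =
    ∫ x in cell L, ∫ Y in cellN n L,
      ‖Ψ.ψ (Matrix.vecCons (x + r) Y)‖ * ‖Ψ.ψ (Matrix.vecCons x Y)‖ := by
  simp_rw [← add_assoc, Ψ.vecCons_add_axis]

/-- **Positivity of the coherence** of a nowhere-vanishing state. [folklore] -/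
theorem coherenceFun_pos (hL : 0 < L) (Ψ : PeriodicTrialState (n + 1) L) (hpos : ∀ X, Ψ.ψ X ≠ 0)
    (r : Space) :
    0 < ∫ x in cell L, ∫ Y in cellN n L,
      ‖Ψ.ψ (Matrix.vecCons (x + r) Y)‖ * ‖Ψ.ψ (Matrix.vecCons x Y)‖ := by
  have hc := Ψ.contDiff.continuous
  have hj := continuous_slicePairing hL Ψ
  have hinner : ∀ x : Space, 0 < ∫ Y in cellN n L,
      ‖Ψ.ψ (Matrix.vecCons (x + r) Y)‖ * ‖Ψ.ψ (Matrix.vecCons x Y)‖ := by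
    intro x
    have hcY : Continuous fun Y : Config n =>
        ‖Ψ.ψ (Matrix.vecCons (x + r) Y)‖ * ‖Ψ.ψ (Matrix.vecCons x Y)‖ := by fun_prop
    rw [integral_pos_iff_support_of_nonneg (fun Y => by positivity) (integrableOn_cellN hcY L)]
    have hsupp : Function.support (fun Y : Config n =>
        ‖Ψ.ψ (Matrix.vecCons (x + r) Y)‖ * ‖Ψ.ψ (Matrix.vecCons x Y)‖) = Set.univ := by
      ext Y
      simp only [Function.mem_support, ne_eq, mul_eq_zero, norm_eq_zero, Set.mem_univ, iff_true]
      push Not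
      exact ⟨hpos _, hpos _⟩
    rw [hsupp, Measure.restrict_apply_univ]
    exact cellN_volume_pos hL n
  have hcx : Continuous fun x : Space => ∫ Y in cellN n L,
      ‖Ψ.ψ (Matrix.vecCons (x + r) Y)‖ * ‖Ψ.ψ (Matrix.vecCons x Y)‖ :=
    hj.comp (Continuous.prodMk continuous_const continuous_id)
  rw [integral_pos_iff_support_of_nonneg (fun x => (hinner x).le) (integrableOn_cell hcx)]
  have hsupp : Function.support (fun x : Space => ∫ Y in cellN n L,
      ‖Ψ.ψ (Matrix.vecCons (x + r) Y)‖ * ‖Ψ.ψ (Matrix.vecCons x Y)‖) = Set.univ := by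
    ext x
    simp only [Function.mem_support, ne_eq, Set.mem_univ, iff_true]
    exact (hinner x).ne'
  rw [hsupp, Measure.restrict_apply_univ]
  exact cell_volume_pos hL

/-- The slice pairing as a Lebesgue integral: `∫⁻_cell∫⁻_{cell^n} |Ψ(x+r,Y)||Ψ(x,Y)| = ofReal g(r)`.
[folklore] -/
theorem lintegral_slicePairing_eq_ofReal (hL : 0 < L) (Ψ : PeriodicTrialState (n + 1) L) (r : Space) :
    (∫⁻ x in cell L, ∫⁻ Y in cellN n L,
      ENNReal.ofReal (‖Ψ.ψ (Matrix.vecCons (x + r) Y)‖ * ‖Ψ.ψ (Matrix.vecCons x Y)‖)) =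
    ENNReal.ofReal (∫ x in cell L, ∫ Y in cellN n L,
      ‖Ψ.ψ (Matrix.vecCons (x + r) Y)‖ * ‖Ψ.ψ (Matrix.vecCons x Y)‖) := by
  have hc := Ψ.contDiff.continuous
  have hj := continuous_slicePairing hL Ψ
  have hinner : ∀ x : Space, (∫⁻ Y in cellN n L,
      ENNReal.ofReal (‖Ψ.ψ (Matrix.vecCons (x + r) Y)‖ * ‖Ψ.ψ (Matrix.vecCons x Y)‖)) =
      ENNReal.ofReal (∫ Y in cellN n L,
        ‖Ψ.ψ (Matrix.vecCons (x + r) Y)‖ * ‖Ψ.ψ (Matrix.vecCons x Y)‖) := by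
    intro x
    have hcY : Continuous fun Y : Config n =>
        ‖Ψ.ψ (Matrix.vecCons (x + r) Y)‖ * ‖Ψ.ψ (Matrix.vecCons x Y)‖ := by fun_prop
    rw [ofReal_integral_eq_lintegral_ofReal (integrableOn_cellN hcY L)
      (Eventually.of_forall fun Y => by positivity)]
  simp_rw [hinner]
  have hcx : Continuous fun x : Space => ∫ Y in cellN n L,
      ‖Ψ.ψ (Matrix.vecCons (x + r) Y)‖ * ‖Ψ.ψ (Matrix.vecCons x Y)‖ :=
    hj.comp (Continuous.prodMk continuous_const continuous_id)
  rw [ofReal_integral_eq_lintegral_ofReal (integrableOn_cell hcx)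
    (Eventually.of_forall fun x => integral_nonneg fun Y => by positivity)]

end Coherence

/-! ### The zero Fourier mode of a real function and the elementary Jensen substitute -/

section ZeroMode

variable {L : ℝ}

/-- The zero Fourier mode of a real function on the cell is its mean: `Re ĉ₀(h) = L⁻³ ∫_cell h`.
[folklore] -/
theorem re_cellFourierCoeff_zero_ofReal (hL : 0 < L) (h : Space → ℝ) :
    (cellFourierCoeff L (fun r => ((h r : ℝ) : ℂ)) 0).re = (L ^ 3)⁻¹ * ∫ r in cell L, h r := by
  rw [cellFourierCoeff_zero hL, integral_complex_ofReal, Complex.smul_re, Complex.ofReal_re,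
    smul_eq_mul]

/-- The logarithm of a continuous nowhere-vanishing function is continuous (as a complex
function). [folklore] -/
theorem continuous_ofReal_log {g : Space → ℝ} (hg : Continuous g) (h0 : ∀ r, g r ≠ 0) :
    Continuous fun r : Space => ((Real.log (g r) : ℝ) : ℂ) :=
  Complex.continuous_ofReal.comp (hg.log h0)

/-- **`L³(1 + Re ĉ₀(log g)) ≤ ∫_cell g`** for a continuous positive `g` (`g ≥ 1 + log g` pointwise
and `Re ĉ₀(log g) = L⁻³∫_cell log g`; with `g` a coherence this is `n₀/N ≥ 1 + ν₀`, the elementary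
substitute for Jensen's inequality `log(L⁻³∫g) ≥ L⁻³∫log g`). [folklore] -/
theorem volume_mul_one_add_zero_mode_le {g : Space → ℝ} (hL : 0 < L) (hgc : Continuous g)
    (hg0 : ∀ r, 0 < g r) :
    L ^ 3 * (1 + (cellFourierCoeff L (fun r : Space => ((Real.log (g r) : ℝ) : ℂ)) 0).re) ≤
      ∫ r in cell L, g r := by
  rw [re_cellFourierCoeff_zero_ofReal hL, mul_add, mul_one, ← mul_assoc,
    mul_inv_cancel₀ (pow_ne_zero _ hL.ne'), one_mul]
  have hlogc : Continuous fun r => Real.log (g r) := hgc.log fun r => (hg0 r).ne'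
  have hvol : (volume.restrict (cell L)).real Set.univ = L ^ 3 := by
    rw [Measure.real, Measure.restrict_apply_univ, volume_cell, ENNReal.toReal_pow,
      ENNReal.toReal_ofReal hL.le]
  have hconst : IntegrableOn (fun _ : Space => (1 : ℝ)) (cell L) volume :=
    integrableOn_cell continuous_const
  have h1 : ∫ r in cell L, (1 + Real.log (g r)) = L ^ 3 + ∫ r in cell L, Real.log (g r) := by
    rw [integral_add hconst (integrableOn_cell hlogc), integral_const, hvol, smul_eq_mul, mul_one]
  rw [← h1]
  refine integral_mono (hconst.add (integrableOn_cell hlogc)) (integrableOn_cell hgc) fun r => ?_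
  have := Real.log_le_sub_one_of_pos (hg0 r)
  simp only
  linarith

end ZeroMode

end Literature.MathematicalPhysics.QuantumManyBody.BoseGas

end
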